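import Summits.HubbardSuperconductivity.HubbardSuperconductivity.Theorems.CapRgSymmetricCertificatePinned.Negative.SchurBound

/-!
# Crux `CapRgSymmetricCertificatePinned` (item `stmt-HubbardSuperconductivity-14045`, route
# `AposterioriCapRg`): the `B₁g` bottom is blind to constants; the `1 × 1` torus is never certified

Negative-side support lemmas from the standing disprover (cdisprove, cycle 1, 2026-08-16; part 2 of 2,
on top of `SchurBound.lean`).  Nothing here asserts a Theses decl.

* §4 `b1gChar_r_one`, `d4Site_r_one`, `rot_odd_of_isB1g`, `sum_sqrt_mul_eq_zero_of_rot_odd` — `D₄` bookkeeping: a `B₁g` function is odd under the rotation by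
  `π/2`, hence `ℓ²(S, √ν)`-orthogonal to constants for rotation-invariant `S`, `ν`.
* §5 **`pairingStrength_le_of_amplitude_sub_const_le`** — under clause (ii′)-Cooper
  (`CooperDominance`) and `C₄ᵥ` covariance of band and BCS weight,
  `λ_d ≤ sup_{S×S} ‖𝒞 - c‖ · Σ_S (√ν)²` for EVERY constant `c`: the `B₁g` bottom is blind to the
  momentum-independent part of the Cooper amplitude, so the first order `+U` certifies nothing
  (`not_symmetricCertifiedAtT_of_cooperAmplitude_const`).  With the physical BCS mass `Σν ≈ 0.19` the
  certified amplitude must oscillate by `≥ (1/8)/0.19 ≈ 0.66` over `S_Λ × S_Λ` inside the sup budget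
  `E₁ = 4`.
* §6 `star_dotProduct_eq_zero_of_isB1g_one`, `not_cooperDominance_one`, `not_symmetricCertifiedAtT_one`,
  `not_symmetricRegimeHoldsT_from_one` — the `1 × 1` torus carries no `B₁g` unit vector, so no `G` is
  certified at `L = 1` and no family is certified from `L₀ = 1` (the natural strengthening "`∀ L ≥ 1`"
  of the certificate is false; `L₀ ≥ 2` is forced).

Sources: folklore; `D₄` characters as in the tree's `b1gChar` / `d4Site` (Scalapino 1995 §2).
-/

noncomputable section

namespace Summit.HubbardSuperconductivity.CapRgSymmetricCertificatePinned.Negative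

open Literature.MathematicalPhysics.QuantumLattice Literature.Probability.LatticeModels Finset Matrix
open scoped BigOperators ComplexConjugate

/-! ## §4 `D₄` bookkeeping: the rotation by `π/2` -/

section Rot

variable {L : ℕ}

/-- `χ_{B₁g}(r) = -1` for the rotation by `π/2`. [folklore] -/
theorem b1gChar_r_one : b1gChar (DihedralGroup.r 1) = -1 := by
  simp only [b1gChar]
  rw [show (1 : ZMod 4).val = 1 by decide]
  norm_num

/-- `d4Site r = rotSite`. [folklore] -/
theorem d4Site_r_one (k : TorusSite 2 L) : d4Site (DihedralGroup.r 1) k = rotSite k := by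
  simp only [d4Site]
  rw [show (1 : ZMod 4).val = 1 by decide, Function.iterate_one]

/-- A `B₁g` function is odd under the rotation by `π/2`. [folklore] -/
theorem rot_odd_of_isB1g {f : TorusSite 2 L → ℂ} (hf : IsB1g f) (k : TorusSite 2 L) :
    f (rotSite k) = -f k := by
  have h := hf (DihedralGroup.r 1) k
  rw [d4Site_r_one, b1gChar_r_one] at h
  rw [h]; ring

/-- **Rotation-odd functions are `ℓ²(S, √ν)`-orthogonal to constants**: for a rotation-invariant
finite set `S` and weight `ν`, `f ∘ rot = -f` gives `Σ_{k∈S} √ν_k f_k = 0`. [folklore] -/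
theorem sum_sqrt_mul_eq_zero_of_rot_odd [NeZero L] (S : Finset (TorusSite 2 L)) (ν : TorusSite 2 L → ℝ)
    (f : TorusSite 2 L → ℂ) (hS : ∀ k, rotSite k ∈ S ↔ k ∈ S) (hν : ∀ k, ν (rotSite k) = ν k)
    (hf : ∀ k, f (rotSite k) = -f k) :
    ∑ k ∈ S, ((Real.sqrt (ν k) : ℝ) : ℂ) * f k = 0 := by
  classical
  let t : TorusSite 2 L → ℂ := fun k => if k ∈ S then ((Real.sqrt (ν k) : ℝ) : ℂ) * f k else 0
  have ht : ∀ k, t k = if k ∈ S then ((Real.sqrt (ν k) : ℝ) : ℂ) * f k else 0 := fun k => rfl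
  have hT : ∑ k ∈ S, ((Real.sqrt (ν k) : ℝ) : ℂ) * f k = ∑ k, t k := by
    simp_rw [ht]
    rw [Finset.sum_ite_mem, Finset.univ_inter]
  -- the rotation by `π/2` as a permutation of the dual torus
  let ρ : TorusSite 2 L ≃ TorusSite 2 L :=
    { toFun := rotSite
      invFun := fun x => ![x 1, -x 0]
      left_inv := fun x => by ext i; fin_cases i <;> simp [rotSite]
      right_inv := fun x => by ext i; fin_cases i <;> simp [rotSite] }
  have hrot : ∑ k, t (rotSite k) = ∑ k, t k := Equiv.sum_comp ρ t
  have hodd : ∀ k, t (rotSite k) = -t k := fun k => by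
    rw [ht, ht k]
    simp only [hS k, hν k, hf k]
    split_ifs <;> ring
  have hsum : ∑ k, t k = -∑ k, t k :=
    calc ∑ k, t k = ∑ k, t (rotSite k) := hrot.symm
      _ = ∑ k, -t k := Finset.sum_congr rfl fun k _ => hodd k
      _ = -∑ k, t k := Finset.sum_neg_distrib _
  have h2 : (2 : ℂ) * ∑ k, t k = 0 := by linear_combination hsum
  rw [hT]
  simpa using h2

end Rot

/-! ## §5 The `B₁g` bottom is blind to the constant part of the Cooper amplitude -/

section Blind

variable {L M : ℕ} [NeZero L] [NeZero M]

/-- **The `B₁g` bottom is blind to constants.**  Under clause (ii′)-Cooper (`CooperDominance`), with a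
rotation-invariant band and BCS weight (the `C₄ᵥ` covariance every frame-`K` Hubbard action has;
hypotheses `he`, `hν`), for EVERY constant `c : ℂ`:

  `λ_d ≤ (sup_{S_Λ×S_Λ} ‖𝒞 - c‖) · Σ_{k∈S_Λ} (√ν_k)²`.

So the momentum-INDEPENDENT part of the Cooper amplitude — in particular the whole first order `+U` —
certifies nothing: the window `λ_d ≥ 1/8` of clause (iii′) must be carried by the momentum dependence
of the scale-`Λ*` Cooper amplitude alone (physically `Σν ≈ 0.19`, so an oscillation `≥ 0.66` over
`S_Λ × S_Λ` inside the sup-norm budget `E₁ = 4`). [folklore] -/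
theorem pairingStrength_le_of_amplitude_sub_const_le (β Λ : ℝ) (e : TorusSite 2 L → ℝ)
    (G : HubbardGrassmann L M) (hdom : CooperDominance (cooperMatrix L M β e Λ G))
    (he : ∀ k, e (rotSite k) = e k)
    (hν : ∀ k, bcsMeasure L M β Λ G (rotSite k) = bcsMeasure L M β Λ G k)
    (c : ℂ) {C : ℝ} (hC : 0 ≤ C)
    (hamp : ∀ k ∈ momentumShell L e Λ, ∀ k' ∈ momentumShell L e Λ,
      ‖cooperAmplitude L M β G k k' - c‖ ≤ C) :
    pairingStrength L M β e Λ G ≤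
      C * ∑ k ∈ momentumShell L e Λ, Real.sqrt (bcsMeasure L M β Λ G k) ^ 2 := by
  classical
  obtain ⟨f, hf1, hB, hbottom, -⟩ := hdom
  -- abbreviations
  have hSrot : ∀ k, rotSite k ∈ momentumShell L e Λ ↔ k ∈ momentumShell L e Λ := fun k => by
    simp only [mem_momentumShell, he]
  -- the constant part of the Cooper matrix annihilates `f`
  have hT : ∑ k ∈ momentumShell L e Λ, ((Real.sqrt (bcsMeasure L M β Λ G k) : ℝ) : ℂ) * f k = 0 :=
    sum_sqrt_mul_eq_zero_of_rot_odd _ _ f hSrot hν (rot_odd_of_isB1g hB)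
  let Atil : Matrix (TorusSite 2 L) (TorusSite 2 L) ℂ := Matrix.of fun k k' =>
    if k ∈ momentumShell L e Λ ∧ k' ∈ momentumShell L e Λ then
      ((Real.sqrt (bcsMeasure L M β Λ G k) : ℝ) : ℂ) * (cooperAmplitude L M β G k k' - c) *
        ((Real.sqrt (bcsMeasure L M β Λ G k') : ℝ) : ℂ)
    else 0
  let P : Matrix (TorusSite 2 L) (TorusSite 2 L) ℂ := Matrix.of fun k k' =>
    if k ∈ momentumShell L e Λ ∧ k' ∈ momentumShell L e Λ then
      ((Real.sqrt (bcsMeasure L M β Λ G k) : ℝ) : ℂ) * c * ((Real.sqrt (bcsMeasure L M β Λ G k') : ℝ) : ℂ)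
    else 0
  have hsplit : cooperMatrix L M β e Λ G = Atil + P := by
    ext k k'
    simp only [cooperMatrix, Matrix.of_apply, Matrix.add_apply, Atil, P]
    split_ifs <;> ring
  have hPf : P *ᵥ f = 0 := by
    ext k
    simp only [Matrix.mulVec, dotProduct, Matrix.of_apply, Pi.zero_apply, P]
    by_cases hk : k ∈ momentumShell L e Λ
    · have : ∀ k', (if k ∈ momentumShell L e Λ ∧ k' ∈ momentumShell L e Λ then
            ((Real.sqrt (bcsMeasure L M β Λ G k) : ℝ) : ℂ) * c *
              ((Real.sqrt (bcsMeasure L M β Λ G k') : ℝ) : ℂ) else 0) * f k' =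
          ((Real.sqrt (bcsMeasure L M β Λ G k) : ℝ) : ℂ) * c *
            (if k' ∈ momentumShell L e Λ then ((Real.sqrt (bcsMeasure L M β Λ G k') : ℝ) : ℂ) * f k' else 0) :=
        fun k' => by
          by_cases hk' : k' ∈ momentumShell L e Λ
          · rw [if_pos ⟨hk, hk'⟩, if_pos hk']; ring
          · rw [if_neg (fun h => hk' h.2), if_neg hk']; ring
      simp_rw [this]
      rw [← Finset.mul_sum, Finset.sum_ite_mem, Finset.univ_inter, hT, mul_zero]
    · refine Finset.sum_eq_zero fun k' _ => ?_
      rw [if_neg (fun h => hk h.1), zero_mul]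
  have hre : reRayleigh (cooperMatrix L M β e Λ G) f = (star f ⬝ᵥ (Atil *ᵥ f)).re := by
    rw [reRayleigh, hsplit, Matrix.add_mulVec, hPf, add_zero]
  have hA : ∀ k k', ‖Atil k k'‖ ≤
      (fun j => if j ∈ momentumShell L e Λ then Real.sqrt (bcsMeasure L M β Λ G j) else 0) k * C *
        (fun j => if j ∈ momentumShell L e Λ then Real.sqrt (bcsMeasure L M β Λ G j) else 0) k' := fun k k' => by
    simp only [Atil, Matrix.of_apply]
    convert norm_sandwich_le (S := momentumShell L e Λ) (w := bcsMeasure L M β Λ G)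
      (F := fun k k' => cooperAmplitude L M β G k k' - c) hamp k k' using 3
  have key := re_neg_rayleigh_le_of_entry_bound Atil _ C hC hA hf1
  rw [Matrix.neg_mulVec, dotProduct_neg, Complex.neg_re, sum_indicator_sqrt_sq] at key
  have hlam : pairingStrength L M β e Λ G = -reRayleigh (cooperMatrix L M β e Λ G) f := by
    rw [hbottom, neg_neg, pairingStrength]
  rw [hlam, hre]
  exact key

/-- **Corollary (first order certifies nothing).**  If the Cooper amplitude is CONSTANT on the shell
(e.g. the bare `+U` of `hubbardInteraction`), a `C₄ᵥ`-covariant `G` with Cooper dominance has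
`λ_d ≤ 0`; hence no certificate with `a > 0`. [folklore] -/
theorem not_symmetricCertifiedAtT_of_cooperAmplitude_const {π : SymmetricRegimeDataT}
    {Θ : SymmetricTolerance} {a b : ℚ} (ha : 0 < a) {Λ β : ℝ} {e : TorusSite 2 L → ℝ}
    {G : HubbardGrassmann L M} {Z : ℂ} (c : ℂ)
    (he : ∀ k, e (rotSite k) = e k)
    (hν : ∀ k, bcsMeasure L M β Λ G (rotSite k) = bcsMeasure L M β Λ G k)
    (hconst : ∀ k ∈ momentumShell L e Λ, ∀ k' ∈ momentumShell L e Λ, cooperAmplitude L M β G k k' = c) :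
    ¬ SymmetricCertifiedAtT π Θ a b Λ L M β e G Z := by
  intro h
  have h1 := h.window.1
  have h2 := pairingStrength_le_of_amplitude_sub_const_le β Λ e G h.cooperDominance he hν c (le_refl (0:ℝ))
    (fun k hk k' hk' => by rw [hconst k hk k' hk', sub_self, norm_zero])
  rw [zero_mul] at h2
  have : (0 : ℝ) < a := by exact_mod_cast ha
  linarith

end Blind

/-! ## §6 The `1 × 1` torus is never certified: no `B₁g` unit vector -/

section SmallTorus

/-- On the `1 × 1` torus every `B₁g` function vanishes (each site is fixed by the rotation `r`,
`χ_{B₁g}(r) = -1`), so it is not a unit vector. [folklore] -/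
theorem star_dotProduct_eq_zero_of_isB1g_one (f : TorusSite 2 1 → ℂ) (hf : IsB1g f) : star f ⬝ᵥ f = 0 := by
  have hzero : ∀ k, f k = 0 := fun k => by
    have h := rot_odd_of_isB1g hf k
    rw [show rotSite k = k from Subsingleton.elim _ _] at h
    have h2 : (2 : ℂ) * f k = 0 := by linear_combination h
    simpa using h2
  simp [dotProduct, hzero]

/-- No matrix on the `1 × 1` torus has `B₁g` Cooper dominance. [folklore] -/
theorem not_cooperDominance_one (A : Matrix (TorusSite 2 1) (TorusSite 2 1) ℂ) : ¬ CooperDominance A := by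
  rintro ⟨f, hf1, hB, -, -⟩
  rw [star_dotProduct_eq_zero_of_isB1g_one f hB] at hf1
  exact zero_ne_one hf1

/-- **The natural strengthening "`∀ L ≥ 1`" of the certificate is false**: at `L = 1` clause (ii′)
fails for EVERY effective action, data, tolerance, interval, scale and normaliser. [folklore] -/
theorem not_symmetricCertifiedAtT_one (π : SymmetricRegimeDataT) (Θ : SymmetricTolerance) (a b : ℚ)
    (Λ : ℝ) (M : ℕ) [NeZero M] (β : ℝ) (e : TorusSite 2 1 → ℝ) (G : HubbardGrassmann 1 M) (Z : ℂ) :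
    ¬ SymmetricCertifiedAtT π Θ a b Λ 1 M β e G Z := fun h =>
  not_cooperDominance_one _ h.cooperDominance

/-- Hence no model family is `T`-certified from `L₀ = 1` with the threshold actually used at `L = 1`:
`SymmetricRegimeHoldsT … 1 …` forces `L₀ = 1 ≤ 1` to be certified — contradiction.  (So every
certificate has `L₀ ≥ 2`; the crux's `∃ L₀` is load-bearing, if only trivially.) [folklore] -/
theorem not_symmetricRegimeHoldsT_from_one (π : SymmetricRegimeDataT) (Θ : SymmetricTolerance) (n : ℝ)
    (eC : (Fin 2 → ℝ) → ℝ) (Λ : ℝ) (e : ∀ (L : ℕ) [NeZero L], TorusSite 2 L → ℝ)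
    (G : ∀ (L M : ℕ) [NeZero L], ℝ → HubbardGrassmann L M) (Z : ∀ (L M : ℕ) [NeZero L], ℝ → ℂ) :
    ¬ SymmetricRegimeHoldsT π Θ n eC Λ 1 e G Z := by
  intro h
  obtain ⟨a, b, -, -, -, hblock⟩ := h.exists_window
  obtain ⟨β₀, hβ₀⟩ := hblock 1 le_rfl
  obtain ⟨M₀, hM₀⟩ := hβ₀ β₀ le_rfl
  haveI : NeZero (M₀ + 1) := ⟨Nat.succ_ne_zero _⟩
  exact not_symmetricCertifiedAtT_one π Θ a b Λ (M₀ + 1) β₀ (e 1) (G 1 (M₀ + 1) β₀) (Z 1 (M₀ + 1) β₀)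
    (hM₀ (M₀ + 1) (Nat.le_succ _))

end SmallTorus

end Summit.HubbardSuperconductivity.CapRgSymmetricCertificatePinned.Negative

end
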